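/-
Copyright (c) 2026 the pub-hodgecm-mathlib formalisation cell (harness21).  Prover seat hodgecm-mathlib-K2E1-p10 (g2), Track B ∕ K2-LIT (build stream 29), h413 = `stmt-HodgeConjecture-24833`,
route of record `HCCMUnconditional`, ROADCARD «5Res ENDGAME BY FAMILIES» §2 C7; dealer K2E1-plan (g7) deals (155)∕(169) — FILE F2b of the C7 split: the K-AVERAGE of a pseudo-Eisenstein series and the
HEAD «`E^{K} = ((L²_cusp)ᗮ)^{K}` is the closed span of the `K`-INVARIANT square-integrable pseudo-Eisenstein series» (generic, and the `U(Φ₂)` print).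
-/
import Summits.HodgeConjecture.HodgeConjecture.Theorems.K2E1PseudoEisensteinSmoothingU   -- ★ F2a p860012 (this seat): the engine `R(η)[θ_Φ] = [θ_{Φ^η}]`
import Summits.HodgeConjecture.HodgeConjecture.Theorems.K2E1KAverageProjectionU        -- ★ F1 p859935 (this seat): `E ⊓ H^{K} = closure span (P_K '' S)`
import Summits.HodgeConjecture.HodgeConjecture.Theorems.K2E1PseudoEisensteinDensityU      -- ★ f1 (K2E1-p02): `cmCuspidalSubspace_orthogonal_eq_topologicalClosure_span_two`
import Mathlib.Topology.UrysohnsLemma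
import HarnessLib

/-!
# h413 ∕ Track B «K2-LIT», ROADCARD «5Res BY FAMILIES» C7, FILE F2b — helper `K2E1PseudoEisensteinKAverageU2`: THE `K`-AVERAGE `P_K[θ_Φ] = [θ_{Φ^♮}]`, `Φ^♮(h) = ∫_K Φ(ι(k)h) dk`, AND THE HEAD
# `((L²_cusp)ᗮ) ∩ L²(X)^{K} = closure span {[θ_Ψ] : Ψ ∈ 𝒯_i, Ψ(ι(k)h) = Ψ(h)}` — generic over ★ `AdelicGroupData`, printed for `U(Φ₂)` of a CM extension

Cell `pub/hodgecm-mathlib`, crux h413 = `stmt-HodgeConjecture-24833`, route of record `HCCMUnconditional`; dealer K2E1-plan (g7) (155)∕(169), ROADCARD §2 C7 (a) («the K-average of θ_Φ is θ of the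
K-average, so `E^{K_U} = closure span{θ_Φ : Φ K_U-invariant}`»).  THEOREMS ONLY (no `def`, no `instance`, no notation, no named-fact hypothesis, no `sorry`); lane `--supports stmt-HodgeConjecture-24833
--as helper` (count-neutral).  Closes no socket.

CONVENTIONS (★ (H2)-d §1 :137 `rightRegular_inv_apply_toLp_pseudoEisenstein`, confirmed here): `X = G(𝔸) ⧸ A_G G(K)` (cosets `gΓ`), `(R(g)f)(x) = f(g⁻¹ • x)`, `θ_Φ(x) = Σ'_q Φ(x̃ q̃)` for `Φ`
RIGHT-`N_i(𝔸)`-invariant, and `R(g⁻¹)[θ_Φ] = [θ_{Φ(g ·)}]`; hence `[θ_Φ]` is `K`-FIXED exactly when `Φ` is LEFT-`K`-invariant, `Φ(ι(k) h) = Φ(h)` — the mirror image of the textbook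
`Φ` on `N(𝔸)P(F)∖G(𝔸)/K`.  `K` is any compact group: a topological group `Kc` with a left-, right- and inversion-invariant probability measure `μK` (its normalised Haar measure) and a
continuous homomorphism `ι : Kc →* G(𝔸)`.

THE MATHEMATICS.  §1 Urysohn: some `η ∈ C_c(G(𝔸), ℂ)` is `≡ 1` on the compact `ι(Kc)`, so the `K`-average `P_K v = ∫_K R(ι k) v dμK` (★ F1) is the integrated operator `R(η)` for the finite
push-forward measure `ν = ι_* μK` (§2), and ★ F2a gives `P_K[θ_Φ] = [θ_{Φ^η}]` with `Φ^η(h) = ∫ η(g)Φ(g⁻¹h) dν = ∫_K Φ(ι(k)⁻¹ h) dμK = ∫_K Φ(ι(k) h) dμK =: Φ^♮(h)` (§3; inversion invariance),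
which is LEFT-`K`-invariant (right invariance of `μK`) and lies in `𝒯_i` (★ F2a §3).  §4 HEAD: with `E := Wᗮ` for any closed `R`-subrepresentation `W` such that `Wᗮ = closure span Θ`
(`Θ = {[θ_Φ] : i, Φ ∈ 𝒯_i}`; for `W = L²_cusp` this is ★ f1), ★ F1 gives `E ∩ H^{K} = closure span (P_K Θ)`, and `P_K Θ ⊆ Θ^{K} := {[θ_Ψ] : Ψ ∈ 𝒯_i left-K-invariant} ⊆ E ∩ H^{K}`, so
**`E ∩ H^{K} = closure span Θ^{K}`**.  §5 prints it for `U(Φ₂)` of a CM extension `L ∕ L⁺` over ★ f1 `cmCuspidalSubspace_orthogonal_eq_topologicalClosure_span_two` (letter-free).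

* §1 `exists_compactlySupported_apply_eq_one`.  §2 `integratedOperator_map_eq_integral` (any unitary strongly continuous `π`).  §3 `smoothed_map_eq_average`, `average_mul_left`,
  `integral_rightRegular_toLp_pseudoEisenstein_eq` (`P_K[θ_Φ] = [θ_{Φ^♮}]`, `Φ^♮ ∈ 𝒯_i`).  §4 `toLp_pseudoEisenstein_mem_invariants_of_forall` (K-invariant `Φ` ⟹ `[θ_Φ]` K-fixed),
  **`orthogonal_inf_invariants_eq_topologicalClosure_span`** (generic head).  §5 **`cmCuspidalSubspace_orthogonal_inf_invariants_eq_topologicalClosure_span_two`** (`U(Φ₂)`, letter-free).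

HONEST LABEL: HC_CM is proved only modulo the 7 printed citations (2 remaining named inputs: hLiu418 = `stmt-HodgeConjecture-24832`, h413 = `stmt-HodgeConjecture-24833`) until rung 0
closes; this file asserts no named fact and closes no socket.
References: [MoeglinWaldspurger1995] C. Mœglin, J.-L. Waldspurger, *Spectral Decomposition and Eisenstein Series*, II.1.1–II.1.4, II.1.12; [BorelJacquet1979] A. Borel, H. Jacquet, *Automorphic
forms and automorphic representations*, PSPM 33.1, §4.6; [DeitmarEchterhoff2014] A. Deitmar, S. Echterhoff, *Principles of Harmonic Analysis*, 2nd ed., Lemma 7.2.6, Prop. 6.2.1;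
[Folland1999] G. B. Folland, *Real Analysis*, §4.5 (Urysohn), Thm. 2.37.
-/

set_option autoImplicit false
set_option linter.dupNamespace false  -- the mandated namespace repeats the summit's segment (`HodgeConjecture.HodgeConjecture`)

noncomputable section

open MeasureTheory Measure Set Filter Topology CompactlySupported NumberField
open Literature.MeasureTheory.Group Literature.NumberTheory.Automorphic Literature.NumberTheory.Automorphic.UnitaryGroup ContRepresentation
open Summit.HodgeConjecture.HodgeConjecture.Cruxes.H413.K2E1PseudoEisensteinCuspOrthogonal (memLp_two_pseudoEisenstein_automorphicQuotient)
open Summit.HodgeConjecture.HodgeConjecture.Cruxes.H413.K2E1PseudoEisensteinDensity (rightRegular_inv_apply_toLp_pseudoEisenstein translate_mul_radical lintegral_tsum_enorm_translate_sq_eq)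
open Summit.HodgeConjecture.HodgeConjecture.Cruxes.H413.K2E1PseudoEisensteinSmoothingU
open Summit.HodgeConjecture.HodgeConjecture.Cruxes.H413.K2E1KAverageProjectionU
open Summit.HodgeConjecture.HodgeConjecture.Cruxes.H413.K2E1CuspidalSpectrumUnitary
open Summit.HodgeConjecture.HodgeConjecture.Cruxes.H413.K2E1PseudoEisensteinDensityU (cmCuspidalSubspace_orthogonal_eq_topologicalClosure_span_two)
open scoped ENNReal NNReal Pointwise InnerProductSpace ComplexConjugate

namespace Summit.HodgeConjecture.HodgeConjecture.Cruxes.H413.K2E1PseudoEisensteinKAverageU2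

universe u

/-! ## §1 Urysohn: a compactly supported continuous `η ≡ 1` on the compact `ι(K)` -/

section Urysohn

variable {G : Type*} [TopologicalSpace G] [T2Space G] [LocallyCompactSpace G] {Kc : Type*} [TopologicalSpace Kc] [CompactSpace Kc]

/-- **A TEST FUNCTION `≡ 1` ON `ι(K)`**: for a continuous map `ι` from a compact space into a locally compact Hausdorff group there is `η ∈ C_c(G, ℂ)` with `η(ι k) = 1` for all `k` (Urysohn's lemma
for the compact `ι(K)` and the closed `∅`). [cite: Folland1999, §4.5] -/
theorem exists_compactlySupported_apply_eq_one {ι : Kc → G} (hι : Continuous ι) : ∃ η : C_c(G, ℂ), ∀ k : Kc, η (ι k) = 1 := by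
  obtain ⟨f, hf1, -, hfc, -⟩ := exists_continuous_one_zero_of_isCompact (isCompact_range hι) isClosed_empty (disjoint_empty _)
  refine ⟨⟨⟨fun g => ((f g : ℝ) : ℂ), Complex.continuous_ofReal.comp f.continuous⟩, hfc.comp_left Complex.ofReal_zero⟩, fun k => ?_⟩
  show ((f (ι k) : ℝ) : ℂ) = 1
  rw [hf1 ⟨k, rfl⟩, Pi.one_apply, Complex.ofReal_one]

end Urysohn

/-! ## §2 The `K`-average is the integrated operator of the push-forward measure `ι_* μK` against such an `η` -/

section Average

variable {G : Type*} [Group G] [TopologicalSpace G] [MeasurableSpace G] [BorelSpace G] [SecondCountableTopology G]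
  {H : Type*} [NormedAddCommGroup H] [InnerProductSpace ℂ H] [CompleteSpace H] {π : ContRepresentation ℂ G H}
  {Kc : Type*} [Group Kc] [TopologicalSpace Kc] [MeasurableSpace Kc] [BorelSpace Kc] (μK : Measure Kc) [IsFiniteMeasure μK] {ι : Kc →* G}

/-- **`R(η)_{ι_*μK} v = ∫_K π(ι k) v dμK`** when `η ≡ 1` on `ι(K)` (change of variables along `ι`; `π` unitary, strongly continuous). [cite: DeitmarEchterhoff2014, Prop. 6.2.1] -/
theorem integratedOperator_map_eq_integral (hu : π.IsUnitary) (hc : π.IsStronglyContinuous) (hι : Continuous ι) {η : C_c(G, ℂ)} (hη : ∀ k : Kc, η (ι k) = 1) (v : H) :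
    π.integratedOperator hu hc (μK.map ι) η v = ∫ k, π (ι k) v ∂μK := by
  have hF : AEStronglyMeasurable (fun g : G => η g • π g v) (μK.map ι) := (η.continuous.smul (hc v)).aestronglyMeasurable
  rw [ContRepresentation.integratedOperator_apply, integral_map hι.measurable.aemeasurable hF]
  exact integral_congr_ae (Eventually.of_forall fun k => by simp only [hη k, one_smul])

end Average

/-! ## §3 `P_K[θ_Φ] = [θ_{Φ^♮}]` with `Φ^♮(h) = ∫_K Φ(ι(k) h) dμK ∈ 𝒯_i`, left-`K`-invariant -/

section Generic

variable {K : Type} [Field K] [NumberField K] (𝒢 : AdelicGroupData.{u} K)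
  [MeasurableSpace 𝒢.Adelic] [BorelSpace 𝒢.Adelic] [LocallyCompactSpace 𝒢.Adelic] [SecondCountableTopology 𝒢.Adelic] [T2Space 𝒢.Adelic]
  [DiscreteTopology 𝒢.quotientSubgroup] (𝔓 : 𝒢.ParabolicUnipotentData) (i : 𝔓.ι)
  (μ : Measure 𝒢.automorphicQuotient) [𝒢.IsAutomorphicMeasure μ]
  {Kc : Type*} [Group Kc] [TopologicalSpace Kc] [IsTopologicalGroup Kc] [MeasurableSpace Kc] [BorelSpace Kc]
  (μK : Measure Kc) [IsProbabilityMeasure μK] (ι : Kc →* 𝒢.Adelic)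

omit [LocallyCompactSpace 𝒢.Adelic] [SecondCountableTopology 𝒢.Adelic] [T2Space 𝒢.Adelic] [DiscreteTopology 𝒢.quotientSubgroup] [TopologicalSpace Kc] [IsTopologicalGroup Kc] [BorelSpace Kc]
  [IsProbabilityMeasure μK] in
/-- **`Φ^η = Φ^♮` FOR `ν = ι_* μK`, `η ≡ 1` ON `ι(K)`**: `∫ η(g) Φ(g⁻¹ h) d(ι_*μK) = ∫_K Φ(ι(k)⁻¹ h) dμK = ∫_K Φ(ι(k) h) dμK` (change of variables; inversion invariance of `μK`).
[cite: Folland1999, Thm. 2.37] -/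
theorem smoothed_map_eq_average [MeasurableInv Kc] [μK.IsInvInvariant] (hι : Measurable ι) {η : 𝒢.Adelic → ℂ} (hηm : Measurable η) (hη : ∀ k : Kc, η (ι k) = 1)
    {Φ : 𝒢.Adelic → ℂ} (hΦm : Measurable Φ) :
    (fun h : 𝒢.Adelic => ∫ g, η g * Φ (g⁻¹ * h) ∂(μK.map ι)) = fun h : 𝒢.Adelic => ∫ k, Φ (ι k * h) ∂μK := by
  funext h
  have hF : AEStronglyMeasurable (fun g : 𝒢.Adelic => η g * Φ (g⁻¹ * h)) (μK.map ι) := (hηm.mul (hΦm.comp (measurable_inv.mul_const h))).aestronglyMeasurable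
  rw [integral_map hι.aemeasurable hF]
  have h1 : (fun k : Kc => η (ι k) * Φ ((ι k)⁻¹ * h)) = fun k : Kc => Φ (ι k⁻¹ * h) := funext fun k => by rw [hη k, one_mul, map_inv]
  rw [h1]
  exact integral_inv_eq_self (fun k : Kc => Φ (ι k * h)) μK

omit [MeasurableSpace 𝒢.Adelic] [BorelSpace 𝒢.Adelic] [LocallyCompactSpace 𝒢.Adelic] [SecondCountableTopology 𝒢.Adelic] [T2Space 𝒢.Adelic] [DiscreteTopology 𝒢.quotientSubgroup]
  [TopologicalSpace Kc] [IsTopologicalGroup Kc] [BorelSpace Kc] [IsProbabilityMeasure μK] in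
/-- **`Φ^♮` IS LEFT-`K`-INVARIANT**: `Φ^♮(ι(k₀) h) = ∫_K Φ(ι(k k₀) h) dμK = Φ^♮(h)` (right invariance of `μK`). [cite: DeitmarEchterhoff2014, Lemma 7.2.6] -/
theorem average_mul_left [MeasurableMul Kc] [μK.IsMulRightInvariant] (Φ : 𝒢.Adelic → ℂ) (k₀ : Kc) (h : 𝒢.Adelic) :
    (fun h : 𝒢.Adelic => ∫ k, Φ (ι k * h) ∂μK) (ι k₀ * h) = (fun h : 𝒢.Adelic => ∫ k, Φ (ι k * h) ∂μK) h := by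
  show ∫ k, Φ (ι k * (ι k₀ * h)) ∂μK = ∫ k, Φ (ι k * h) ∂μK
  have h1 : (fun k : Kc => Φ (ι k * (ι k₀ * h))) = fun k : Kc => Φ (ι (k * k₀) * h) := funext fun k => by rw [map_mul, mul_assoc]
  rw [h1]
  exact integral_mul_right_eq_self (fun k : Kc => Φ (ι k * h)) k₀

variable [SecondCountableTopology Kc] [CompactSpace Kc] [μK.IsMulLeftInvariant] [μK.IsMulRightInvariant] [μK.IsInvInvariant]

omit [μK.IsMulLeftInvariant] [μK.IsMulRightInvariant] in
/-- **`P_K[θ_Φ] = [θ_{Φ^♮}]`, `Φ^♮ ∈ 𝒯_i`**: the `K`-average `∫_K R(ι k)[θ_Φ] dμK` (★ F1) of the class of a square-integrable pseudo-Eisenstein series is the class of `θ_{Φ^♮}`,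
`Φ^♮(h) = ∫_K Φ(ι(k) h) dμK`, and `Φ^♮` is Borel, right-`N_i(𝔸)`-invariant, square-summable (§1–§2 + ★ F2a `integratedOperator_toLp_pseudoEisenstein_eq` at `ν = ι_*μK`).
[cite: MoeglinWaldspurger1995, II.1.1–II.1.3] [cite: DeitmarEchterhoff2014, Lemma 7.2.6] -/
theorem integral_rightRegular_toLp_pseudoEisenstein_eq (hι : Continuous ι) {Φ : 𝒢.Adelic → ℂ} (hΦm : Measurable Φ) (hΦ : ∀ (g : 𝒢.Adelic) (n : 𝔓.radical i), Φ (g * n) = Φ g)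
    (h2 : ∫⁻ x, (∑' q : 𝒢.quotientSubgroup ⧸ (𝔓.radical i).subgroupOf 𝒢.quotientSubgroup,
        ‖Φ ((Quotient.out x : 𝒢.Adelic) * ((q.out : 𝒢.quotientSubgroup) : 𝒢.Adelic))‖ₑ) ^ 2 ∂μ < ∞) :
    ∃ (hm : Measurable fun h : 𝒢.Adelic => ∫ k, Φ (ι k * h) ∂μK)
      (hN : ∀ (h : 𝒢.Adelic) (n : 𝔓.radical i), (fun h : 𝒢.Adelic => ∫ k, Φ (ι k * h) ∂μK) (h * n) = (fun h : 𝒢.Adelic => ∫ k, Φ (ι k * h) ∂μK) h)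
      (h2' : ∫⁻ x, (∑' q : 𝒢.quotientSubgroup ⧸ (𝔓.radical i).subgroupOf 𝒢.quotientSubgroup,
        ‖(fun h : 𝒢.Adelic => ∫ k, Φ (ι k * h) ∂μK) ((Quotient.out x : 𝒢.Adelic) * ((q.out : 𝒢.quotientSubgroup) : 𝒢.Adelic))‖ₑ) ^ 2 ∂μ < ∞),
      ∫ k, 𝒢.rightRegular μ (ι k) ((memLp_two_pseudoEisenstein_automorphicQuotient 𝒢 𝔓 i μ hΦm hΦ h2).toLp _) ∂μK =
        (memLp_two_pseudoEisenstein_automorphicQuotient 𝒢 𝔓 i μ (Φ := fun h : 𝒢.Adelic => ∫ k, Φ (ι k * h) ∂μK) hm hN h2').toLp _ := by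
  obtain ⟨η, hη⟩ := exists_compactlySupported_apply_eq_one (G := 𝒢.Adelic) hι
  have heq := smoothed_map_eq_average 𝒢 μK ι hι.measurable η.continuous.measurable hη hΦm
  have hm : Measurable fun h : 𝒢.Adelic => ∫ k, Φ (ι k * h) ∂μK := heq ▸ measurable_smoothed 𝒢 (μK.map ι) η hΦm
  have hN : ∀ (h : 𝒢.Adelic) (n : 𝔓.radical i), (fun h : 𝒢.Adelic => ∫ k, Φ (ι k * h) ∂μK) (h * n) = (fun h : 𝒢.Adelic => ∫ k, Φ (ι k * h) ∂μK) h :=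
    heq ▸ smoothed_mul_radical 𝒢 𝔓 i (μK.map ι) η hΦ
  have h2' : ∫⁻ x, (∑' q : 𝒢.quotientSubgroup ⧸ (𝔓.radical i).subgroupOf 𝒢.quotientSubgroup,
      ‖(fun h : 𝒢.Adelic => ∫ k, Φ (ι k * h) ∂μK) ((Quotient.out x : 𝒢.Adelic) * ((q.out : 𝒢.quotientSubgroup) : 𝒢.Adelic))‖ₑ) ^ 2 ∂μ < ∞ :=
    heq ▸ lintegral_tsum_enorm_smoothed_sq_lt_top 𝒢 𝔓 i μ (μK.map ι) η hΦm hΦ h2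
  refine ⟨hm, hN, h2', ?_⟩
  calc ∫ k, 𝒢.rightRegular μ (ι k) ((memLp_two_pseudoEisenstein_automorphicQuotient 𝒢 𝔓 i μ hΦm hΦ h2).toLp _) ∂μK
      = (𝒢.rightRegular μ).integratedOperator (𝒢.isUnitary_rightRegular μ) (𝒢.isStronglyContinuous_rightRegular_holds μ) (μK.map ι) η
          ((memLp_two_pseudoEisenstein_automorphicQuotient 𝒢 𝔓 i μ hΦm hΦ h2).toLp _) :=
        (integratedOperator_map_eq_integral μK (𝒢.isUnitary_rightRegular μ) (𝒢.isStronglyContinuous_rightRegular_holds μ) hι hη _).symm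
    _ = _ := integratedOperator_toLp_pseudoEisenstein_eq 𝒢 𝔓 i μ (μK.map ι) η hΦm hΦ h2
    _ = _ := MemLp.toLp_congr _ _ (Eventually.of_forall fun x => tsum_congr fun q => congrFun heq _)

/-! ## §4 The head: `Wᗮ ∩ L²(X)^{K} = closure span {[θ_Ψ] : Ψ ∈ 𝒯_i left-K-invariant}` whenever `Wᗮ = closure span {[θ_Φ] : Φ ∈ 𝒯_i}` -/

omit [TopologicalSpace Kc] [IsTopologicalGroup Kc] [MeasurableSpace Kc] [BorelSpace Kc] [SecondCountableTopology Kc] [CompactSpace Kc] in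
/-- **A LEFT-`K`-INVARIANT `Φ ∈ 𝒯_i` GIVES A `K`-FIXED CLASS `[θ_Φ]`**: `R(ι k)[θ_Φ] = [θ_{Φ(ι(k)⁻¹ ·)}] = [θ_Φ]` (★ (H2)-d `rightRegular_inv_apply_toLp_pseudoEisenstein`).
[cite: MoeglinWaldspurger1995, II.1.1] -/
theorem toLp_pseudoEisenstein_mem_invariants_of_forall (ι : Kc →* 𝒢.Adelic) {Φ : 𝒢.Adelic → ℂ} (hΦm : Measurable Φ) (hΦ : ∀ (g : 𝒢.Adelic) (n : 𝔓.radical i), Φ (g * n) = Φ g)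
    (h2 : ∫⁻ x, (∑' q : 𝒢.quotientSubgroup ⧸ (𝔓.radical i).subgroupOf 𝒢.quotientSubgroup,
        ‖Φ ((Quotient.out x : 𝒢.Adelic) * ((q.out : 𝒢.quotientSubgroup) : 𝒢.Adelic))‖ₑ) ^ 2 ∂μ < ∞) (hK : ∀ (k : Kc) (h : 𝒢.Adelic), Φ (ι k * h) = Φ h) :
    (memLp_two_pseudoEisenstein_automorphicQuotient 𝒢 𝔓 i μ hΦm hΦ h2).toLp _ ∈ ((𝒢.rightRegular μ).restrict ι).invariants := by
  intro k
  rw [ContRepresentation.restrict_apply_apply]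
  have hg : ι k = ((ι k)⁻¹)⁻¹ := (inv_inv _).symm
  have h2g : ∫⁻ x, (∑' q : 𝒢.quotientSubgroup ⧸ (𝔓.radical i).subgroupOf 𝒢.quotientSubgroup,
      ‖(fun h => Φ ((ι k)⁻¹ * h)) ((Quotient.out x : 𝒢.Adelic) * ((q.out : 𝒢.quotientSubgroup) : 𝒢.Adelic))‖ₑ) ^ 2 ∂μ < ∞ := by
    rw [lintegral_tsum_enorm_translate_sq_eq 𝒢 𝔓 i μ hΦ (ι k)⁻¹]; exact h2
  rw [hg, rightRegular_inv_apply_toLp_pseudoEisenstein 𝒢 𝔓 i μ hΦm hΦ h2 (ι k)⁻¹ (hΦm.comp (measurable_const_mul _)) (translate_mul_radical 𝒢 𝔓 i hΦ _) h2g]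
  exact MemLp.toLp_congr _ _ (Eventually.of_forall fun x => tsum_congr fun q => by simp only [← map_inv, hK])

include μK in
/-- **THE HEAD (generic)**: for a closed `R`-stable `W ≤ L²(X)` whose orthogonal complement is the closed span of the square-integrable pseudo-Eisenstein classes `Θ = {[θ_Φ] : i, Φ ∈ 𝒯_i}` (`hE`;
for `W = L²_cusp` this is ★ f1), and a compact group `K → G(𝔸)`: **`Wᗮ ⊓ L²(X)^{K} = closure span Θ^{K}`, `Θ^{K} = {[θ_Ψ] : i, Ψ ∈ 𝒯_i, Ψ(ι(k) h) = Ψ(h)}`** — `⊆`: ★ F1 writes a `K`-fixed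
`v ∈ Wᗮ` as a limit of combinations of `P_K[θ_Φ] = [θ_{Φ^♮}]` (§3), `Φ^♮ ∈ 𝒯_i` left-`K`-invariant; `⊇`: such `[θ_Ψ]` lie in `Wᗮ` and are `K`-fixed (`toLp_pseudoEisenstein_mem_invariants_of_forall`).
(The sets enter through the abbreviation hypotheses `hΘ`, `hΘK` — pass `rfl rfl`.) [cite: MoeglinWaldspurger1995, II.1.2–II.1.4] [cite: DeitmarEchterhoff2014, Lemma 7.2.6] -/
theorem orthogonal_inf_invariants_eq_topologicalClosure_span (hι : Continuous ι) (W : ClosedSubrep (𝒢.rightRegular μ)) {Θ ΘK : Set (𝒢.L2 μ)}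
    (hΘ : Θ = {f : 𝒢.L2 μ | ∃ (i : 𝔓.ι) (Φ : 𝒢.Adelic → ℂ) (_ : Measurable Φ) (_ : ∀ (g : 𝒢.Adelic) (n : 𝔓.radical i), Φ (g * n) = Φ g)
        (_ : ∫⁻ x, (∑' q : 𝒢.quotientSubgroup ⧸ (𝔓.radical i).subgroupOf 𝒢.quotientSubgroup, ‖Φ ((Quotient.out x : 𝒢.Adelic) * ((q.out : 𝒢.quotientSubgroup) : 𝒢.Adelic))‖ₑ) ^ 2 ∂μ < ∞)
        (hθ : MemLp (fun x : 𝒢.automorphicQuotient => ∑' q : 𝒢.quotientSubgroup ⧸ (𝔓.radical i).subgroupOf 𝒢.quotientSubgroup,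
          Φ ((Quotient.out x : 𝒢.Adelic) * ((q.out : 𝒢.quotientSubgroup) : 𝒢.Adelic))) 2 μ), f = hθ.toLp _})
    (hΘK : ΘK = {f : 𝒢.L2 μ | ∃ (i : 𝔓.ι) (Φ : 𝒢.Adelic → ℂ) (_ : Measurable Φ) (_ : ∀ (g : 𝒢.Adelic) (n : 𝔓.radical i), Φ (g * n) = Φ g)
        (_ : ∫⁻ x, (∑' q : 𝒢.quotientSubgroup ⧸ (𝔓.radical i).subgroupOf 𝒢.quotientSubgroup, ‖Φ ((Quotient.out x : 𝒢.Adelic) * ((q.out : 𝒢.quotientSubgroup) : 𝒢.Adelic))‖ₑ) ^ 2 ∂μ < ∞)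
        (_ : ∀ (k : Kc) (h : 𝒢.Adelic), Φ (ι k * h) = Φ h)
        (hθ : MemLp (fun x : 𝒢.automorphicQuotient => ∑' q : 𝒢.quotientSubgroup ⧸ (𝔓.radical i).subgroupOf 𝒢.quotientSubgroup,
          Φ ((Quotient.out x : 𝒢.Adelic) * ((q.out : 𝒢.quotientSubgroup) : 𝒢.Adelic))) 2 μ), f = hθ.toLp _})
    (hE : (W.toSubmodule)ᗮ = (Submodule.span ℂ Θ).topologicalClosure) :
    (W.toSubmodule)ᗮ ⊓ ((𝒢.rightRegular μ).restrict ι).invariants = (Submodule.span ℂ ΘK).topologicalClosure := by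
  -- the data for ★ F1
  have hu := 𝒢.isUnitary_rightRegular μ
  have hc : ((𝒢.rightRegular μ).restrict ι).IsStronglyContinuous := fun v => ((𝒢.isStronglyContinuous_rightRegular_holds μ) v).comp hι
  have hEW : (W.orthogonal hu).toSubmodule = (W.toSubmodule)ᗮ := ClosedSubrep.toSubmodule_orthogonal hu W
  have hSE : Θ ⊆ W.orthogonal hu := fun f hf => by
    show f ∈ (W.orthogonal hu).toSubmodule
    rw [hEW, hE]
    exact Submodule.le_topologicalClosure _ (Submodule.subset_span hf)
  have hES : (W.orthogonal hu).toSubmodule ≤ (Submodule.span ℂ Θ).topologicalClosure := by rw [hEW, hE]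
  have hF1 := inf_invariants_eq_topologicalClosure_span_image_average ι μK hu hc (W.orthogonal hu) hSE hES
  rw [hEW] at hF1
  -- (a) the average of an element of `Θ` lies in `ΘK`
  have ha : ∀ f ∈ Θ, (∫ k, 𝒢.rightRegular μ (ι k) f ∂μK) ∈ ΘK := by
    intro f hf
    rw [hΘ] at hf
    obtain ⟨j, Φ, hΦm, hΦ, h2, hθ, rfl⟩ := hf
    obtain ⟨hm, hN, h2', heq⟩ := integral_rightRegular_toLp_pseudoEisenstein_eq 𝒢 𝔓 j μ μK ι hι hΦm hΦ h2
    rw [hΘK]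
    exact ⟨j, fun h : 𝒢.Adelic => ∫ k, Φ (ι k * h) ∂μK, hm, hN, h2', fun k h => average_mul_left 𝒢 μK ι Φ k h,
      memLp_two_pseudoEisenstein_automorphicQuotient 𝒢 𝔓 j μ hm hN h2', heq⟩
  -- (b) `ΘK ⊆ Wᗮ ⊓ H^K`
  have hb : ΘK ⊆ ((W.toSubmodule)ᗮ ⊓ ((𝒢.rightRegular μ).restrict ι).invariants : Submodule ℂ (𝒢.L2 μ)) := by
    intro f hf
    rw [hΘK] at hf
    obtain ⟨j, Φ, hΦm, hΦ, h2, hK, hθ, rfl⟩ := hf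
    refine ⟨?_, toLp_pseudoEisenstein_mem_invariants_of_forall 𝒢 𝔓 j μ ι hΦm hΦ h2 hK⟩
    rw [← hEW]
    exact hSE (by rw [hΘ]; exact ⟨j, Φ, hΦm, hΦ, h2, hθ, rfl⟩)
  -- assemble
  refine le_antisymm ?_ ?_
  · rw [hF1]
    refine Submodule.topologicalClosure_mono (Submodule.span_le.2 ?_)
    rintro _ ⟨f, hf, rfl⟩
    exact Submodule.subset_span (ha f hf)
  · refine Submodule.topologicalClosure_minimal _ (Submodule.span_le.2 hb) ?_
    rw [hF1]
    exact Submodule.isClosed_topologicalClosure _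

end Generic

/-! ## §5 The print for `U(Φ₂)` of a CM extension: `((L²_cusp)ᗮ)^{K}` is the closed span of the `K`-invariant square-integrable pseudo-Eisenstein series -/

section CMTwo

variable (L : Type) [Field L] [NumberField L] [IsCMField L]
  [MeasurableSpace (cmDatum L 2 (Matrix.of fun i j : Fin 2 => if i.val + j.val + 1 = 2 then (1 : L) else 0)).Adelic]
  [BorelSpace (cmDatum L 2 (Matrix.of fun i j : Fin 2 => if i.val + j.val + 1 = 2 then (1 : L) else 0)).Adelic]
  (μ : Measure (cmDatum L 2 (Matrix.of fun i j : Fin 2 => if i.val + j.val + 1 = 2 then (1 : L) else 0)).automorphicQuotient)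
  [(cmDatum L 2 (Matrix.of fun i j : Fin 2 => if i.val + j.val + 1 = 2 then (1 : L) else 0)).IsAutomorphicMeasure μ]
  {Kc : Type*} [Group Kc] [TopologicalSpace Kc] [IsTopologicalGroup Kc] [CompactSpace Kc] [SecondCountableTopology Kc] [MeasurableSpace Kc] [BorelSpace Kc]
  (μK : Measure Kc) [IsProbabilityMeasure μK] [μK.IsMulLeftInvariant] [μK.IsMulRightInvariant] [μK.IsInvInvariant]
  (ι : Kc →* (cmDatum L 2 (Matrix.of fun i j : Fin 2 => if i.val + j.val + 1 = 2 then (1 : L) else 0)).Adelic)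

include μK in
/-- **`E^{K} = ((L²_cusp(U(Φ₂)))ᗮ)^{K} = closure span {[θ_Ψ] : i, Ψ ∈ 𝒯_i LEFT-K-INVARIANT}`, LETTER-FREE** — for every automorphic `μ` on `X = U(Φ₂)(L⁺)∖U(Φ₂)(𝔸_{L⁺})`... (in the tree's
convention `X = G(𝔸) ⧸ G(K)`) and every compact group `(Kc, μK)` with a continuous `ι : Kc →* U(Φ₂)(𝔸)`: §4 over ★ f1 `cmCuspidalSubspace_orthogonal_eq_topologicalClosure_span_two`.  This is ROADCARD C7 (a):
the trivial-`K`-type part of `(L²_cusp)ᗮ` is spanned by the `K`-invariant pseudo-Eisenstein series; FILE F3 splits these along the compact abelian `Y¹` into families.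
[cite: MoeglinWaldspurger1995, II.1.2–II.1.4, II.1.12] [cite: DeitmarEchterhoff2014, Lemma 7.2.6] -/
theorem cmCuspidalSubspace_orthogonal_inf_invariants_eq_topologicalClosure_span_two (hι : Continuous ι) :
    ((cmCuspidalSubspace L 2 μ).toSubmodule)ᗮ ⊓ (((cmDatum L 2 (Matrix.of fun i j : Fin 2 => if i.val + j.val + 1 = 2 then (1 : L) else 0)).rightRegular μ).restrict ι).invariants =
      (Submodule.span ℂ {f : (cmDatum L 2 (Matrix.of fun i j : Fin 2 => if i.val + j.val + 1 = 2 then (1 : L) else 0)).L2 μ |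
        ∃ (i : (cmParabolicData L 2).ι) (Φ : (cmDatum L 2 (Matrix.of fun i j : Fin 2 => if i.val + j.val + 1 = 2 then (1 : L) else 0)).Adelic → ℂ) (_ : Measurable Φ)
          (_ : ∀ (g : (cmDatum L 2 (Matrix.of fun i j : Fin 2 => if i.val + j.val + 1 = 2 then (1 : L) else 0)).Adelic) (n : (cmParabolicData L 2).radical i), Φ (g * n) = Φ g)
          (_ : ∫⁻ x, (∑' q : (cmDatum L 2 (Matrix.of fun i j : Fin 2 => if i.val + j.val + 1 = 2 then (1 : L) else 0)).quotientSubgroup ⧸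
              ((cmParabolicData L 2).radical i).subgroupOf (cmDatum L 2 (Matrix.of fun i j : Fin 2 => if i.val + j.val + 1 = 2 then (1 : L) else 0)).quotientSubgroup,
                ‖Φ ((Quotient.out x : (cmDatum L 2 (Matrix.of fun i j : Fin 2 => if i.val + j.val + 1 = 2 then (1 : L) else 0)).Adelic) *
                  (q.out : (cmDatum L 2 (Matrix.of fun i j : Fin 2 => if i.val + j.val + 1 = 2 then (1 : L) else 0)).Adelic))‖ₑ) ^ 2 ∂μ < ∞)
          (_ : ∀ (k : Kc) (h : (cmDatum L 2 (Matrix.of fun i j : Fin 2 => if i.val + j.val + 1 = 2 then (1 : L) else 0)).Adelic), Φ (ι k * h) = Φ h)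
          (hθ : MemLp (fun x : (cmDatum L 2 (Matrix.of fun i j : Fin 2 => if i.val + j.val + 1 = 2 then (1 : L) else 0)).automorphicQuotient =>
              ∑' q : (cmDatum L 2 (Matrix.of fun i j : Fin 2 => if i.val + j.val + 1 = 2 then (1 : L) else 0)).quotientSubgroup ⧸
                ((cmParabolicData L 2).radical i).subgroupOf (cmDatum L 2 (Matrix.of fun i j : Fin 2 => if i.val + j.val + 1 = 2 then (1 : L) else 0)).quotientSubgroup,
                  Φ ((Quotient.out x : (cmDatum L 2 (Matrix.of fun i j : Fin 2 => if i.val + j.val + 1 = 2 then (1 : L) else 0)).Adelic) *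
                    (q.out : (cmDatum L 2 (Matrix.of fun i j : Fin 2 => if i.val + j.val + 1 = 2 then (1 : L) else 0)).Adelic))) 2 μ),
          f = hθ.toLp _}).topologicalClosure := by
  haveI := discreteTopology_cmDatum_quotientSubgroup L 2 (Matrix.of fun i j : Fin 2 => if i.val + j.val + 1 = 2 then (1 : L) else 0)
  exact orthogonal_inf_invariants_eq_topologicalClosure_span (cmDatum L 2 (Matrix.of fun i j : Fin 2 => if i.val + j.val + 1 = 2 then (1 : L) else 0)) (cmParabolicData L 2) μ μK ι hι
    (cmCuspidalSubspace L 2 μ) rfl rfl (cmCuspidalSubspace_orthogonal_eq_topologicalClosure_span_two L μ)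

end CMTwo

end Summit.HodgeConjecture.HodgeConjecture.Cruxes.H413.K2E1PseudoEisensteinKAverageU2

end
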